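import Literature.Barriers.SmoothPoincare4.GluckTwistsDissolve
import Literature.Barriers.SmoothPoincare4.GluckTwistsDissolveRasmussenProofs
import Literature.Barriers.SmoothPoincare4.GluckTwistsDissolveConnectedSumProofs
import Literature.Topology.FourManifolds.ConnectedSumSphereIdentity
import Literature.Topology.FourManifolds.GluckTwistProofs
import Literature.Topology.FourManifolds.GluckTwistHomotopySphereProofs
import HarnessLib

/-!
# MMSW 2023 §9.3 (`mmsw2023_sZero_of_dissolvesInCP2`): what it contains and what is left (sibling of `GluckTwistsDissolve.lean`)

Sibling proof file of `Literature/Barriers/SmoothPoincare4/GluckTwistsDissolve.lean` for the named fact of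
its section "Beyond Gluck twists", `Literature.Barriers.SmoothPoincare4.mmsw2023_sZero_of_dissolvesInCP2`
(Manolescu–Marengon–Sarkar–Willis, Duke Math. J. 172 (2023), §9.3, the sentence after Question 9.11, case
`r = 1`, knots: every knot slice in `X ∖ B̊⁴`, `X` a closed smooth homotopy 4-sphere all of whose closed smooth
connected sums with `ℂℙ²` are `≅ ℂℙ²` (`DissolvesInCP2 X`), has `s = 0`). Everything here is **proved**; no
definition and no named fact is introduced (D-0026). The fact itself is NOT discharged (its printed proof
rests on Cor. 6.13, the adjunction inequality for `s` in `#ᵗ ℂℙ²bar`, via cobordism maps on Lee homology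
which the tree's knots-only Lee complex does not have — the same gap recorded for Cor. 1.13 in
`GluckTwistsDissolveRasmussenProofs.lean`).

## What is proved here

* `dissolvesInCP2_sphere` — **`S⁴` dissolves**: every closed smooth connected sum of `S⁴` with `ℂℙ²` is
  `≅ ℂℙ²` (Kervaire–Milnor, "`Sⁿ` serves as identity": tree theorem
  `nonempty_diffeomorph_of_isConnectedSum_sphere'`).
* `dissolvesInCP2_of_isGluckTwist'` — **every Gluck twist of `S⁴` dissolves, UNCONDITIONALLY**: the
  dissolution fact `gluckTwist_connectedSum_complexProjectivePlane` entering
  `dissolvesInCP2_of_isGluckTwist` is the tree theorem `gluckTwist_connectedSum_complexProjectivePlane_holds`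
  (`GluckTwistsDissolveConnectedSumProofs.lean`).
* `mmsw2023_sZero_of_dissolvesInCP2.eq_zero_of_isSmoothlySlice` — **the §9.3 fact contains Rasmussen's
  slice theorem** `Literature.Topology.FourManifolds.eq_zero_of_isSmoothlySlice` (`X = S⁴`: a slice disc in
  `B⁴` is a slice disc in `S⁴ ∖ B̊⁴`, `Knot.IsSliceDisc.isSliceDiscIn_sphere`).
* `mmsw2023_sZero_of_dissolvesInCP2.rasmussen_eq_zero_of_isSliceDiscIn_gluckTwist` — **the §9.3 fact
  contains MMSW Cor. 1.13 (knot case) in full**, UNCONDITIONALLY: a (Hausdorff, second countable) smooth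
  Gluck twist of `S⁴` is compact (`IsGluckTwist.compactSpace_holds`), a homotopy 4-sphere
  (`nonempty_homotopyEquiv_sphere_of_isGluckTwist_holds`) and dissolves (previous item). So of the two
  `s`-facts of the catalogue entry only the §9.3 one needs discharging.
* `mmsw2023_sZero_of_dissolvesInCP2_of_nonpos`, `mmsw2023_sZero_of_dissolvesInCP2_iff_nonpos` — **"conclude
  as in Theorem 6.14"**: with no hypothesis the §9.3 fact is EQUIVALENT to the ONE-SIDED bound "`s ≤ 0` for
  every knot slice (tree sense) in a closed smooth homotopy 4-sphere that `DissolvesInCP2`" — Equation (6.1)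
  of the source for such spheres, i.e. exactly Cor. 6.13 after dissolution; the symmetrisation uses the
  tree theorems `Knot.IsSliceDiscIn.mirror` (the reflected ball) and `HasRasmussenInvariant.mirror_holds`
  (`s(K̄) = -s(K)`, Rasmussen 2010, §3.5). This is the interface the missing adjunction-inequality layer has
  to meet, now for all dissolving homotopy spheres at once.

## References

* C. Manolescu, M. Marengon, S. Sarkar, M. Willis, *A generalization of Rasmussen's invariant, with
  applications to surfaces in some four-manifolds*, Duke Math. J. 172 (2023) 231–311 (arXiv:1910.08195):
  §9.3 (remark after Question 9.11), Cor. 6.13, Thm. 6.14, Cor. 6.15 and its proof.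
  [cite: ManolescuMarengonSarkarWillis2023, §9.3]
* J. Rasmussen, *Khovanov homology and the slice genus*, Invent. Math. 182 (2010) 419–447: Thm. 1, §3.5.
  [cite: Rasmussen2010, Thm. 1]
* M. Kervaire, J. Milnor, *Groups of homotopy spheres I*, Ann. of Math. 77 (1963), §2. [cite: KervaireMilnor1963, §2]

## Design notes

No definitions, no named facts, no instances; user: the zero-surgery crux work
(`Summits/SmoothPoincare4/SmoothPoincare4/Theorems/ZseCruxRasmussen/Negative/`, `…/Cruxes/ZseCruxRasmussen/Disproof.lean`).
-/

noncomputable section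

open scoped Manifold ContDiff
open ContinuousMap

namespace Literature.Barriers.SmoothPoincare4

open Literature.Topology.FourManifolds

/-- Local notation: the standard `4`-sphere `𝕊⁴ ⊂ ℝ⁵`. -/
local notation "𝕊⁴" => (Metric.sphere (0 : EuclideanSpace ℝ (Fin 5)) 1)

/-! ### Spheres that dissolve: `S⁴` and every Gluck twist, unconditionally -/

/-- **`S⁴` dissolves in `ℂℙ²`**: every closed smooth connected sum of `S⁴` with `ℂℙ²` is diffeomorphic
to `ℂℙ²` — `ℂℙ² # S⁴ ≅ ℂℙ²` for connected sums along arbitrary discs (tree theorem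
`nonempty_diffeomorph_of_isConnectedSum_sphere'`, after `IsConnectedSum.symm`).
[cite: KervaireMilnor1963, §2] -/
theorem dissolvesInCP2_sphere : DissolvesInCP2 𝕊⁴ :=
  fun _P _ _ _ _ _ _ hP ↦ nonempty_diffeomorph_of_isConnectedSum_sphere' hP.symm

/-- **Every Gluck twist of `S⁴` dissolves in `ℂℙ²`, unconditionally**: the dissolution fact is the tree
theorem `gluckTwist_connectedSum_complexProjectivePlane_holds`. [cite: KasprowskiPowellRay2023, Lemma 3.1]
[cite: ManolescuMarengonSarkarWillis2023, proof of Cor. 6.15] -/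
theorem dissolvesInCP2_of_isGluckTwist' (K₂ : TwoKnot) (X : Type) [TopologicalSpace X] [T2Space X]
    [SecondCountableTopology X] [ChartedSpace (EuclideanSpace ℝ (Fin 4)) X] [IsManifold (𝓡 4) ∞ X]
    (hX : IsGluckTwist (𝓡 4) X K₂) : DissolvesInCP2 X :=
  dissolvesInCP2_of_isGluckTwist gluckTwist_connectedSum_complexProjectivePlane_holds K₂ X hX

/-! ### The case `X = S⁴`: Rasmussen's slice theorem -/

/-- **The §9.3 fact contains Rasmussen's theorem `s(slice knot) = 0`.** GIVEN
`mmsw2023_sZero_of_dissolvesInCP2`, every smoothly slice knot has `s = 0`, i.e. the named fact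
`Literature.Topology.FourManifolds.eq_zero_of_isSmoothlySlice` (Rasmussen 2010, Thm. 1; MMSW 2023, Thm. 6.14
for `|L| = 1`) holds: `S⁴` is a closed smooth homotopy 4-sphere which dissolves (`dissolvesInCP2_sphere`),
and a slice disc `g` for `K` in `B⁴` is a proper slice disc in `S⁴ ∖ c⁻¹(B̊⁴)` for the inverse
stereographic chart at `a = (1,0,0,0,0)` (`Knot.IsSliceDisc.isSliceDiscIn_sphere`).
[cite: ManolescuMarengonSarkarWillis2023, §9.3 and Thm. 6.14] [cite: Rasmussen2010, Thm. 1] -/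
theorem mmsw2023_sZero_of_dissolvesInCP2.eq_zero_of_isSmoothlySlice
    (h : mmsw2023_sZero_of_dissolvesInCP2) : eq_zero_of_isSmoothlySlice := by
  intro K s hs hK
  obtain ⟨g, hg⟩ := hK
  exact h 𝕊⁴ ⟨ContinuousMap.HomotopyEquiv.refl _⟩ dissolvesInCP2_sphere K _ _
    (hg.isSliceDiscIn_sphere ⟨EuclideanSpace.single 0 1, by simp⟩) s hs

/-! ### The Gluck-twist case: MMSW Cor. 1.13 (knots), unconditionally -/

/-- **The §9.3 fact contains Cor. 1.13 (knot case) in full.** GIVEN `mmsw2023_sZero_of_dissolvesInCP2`, the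
named fact `rasmussen_eq_zero_of_isSliceDiscIn_gluckTwist` holds: a (Hausdorff, second countable) smooth
Gluck twist `X` of `S⁴` is compact (`IsGluckTwist.compactSpace_holds`), a homotopy 4-sphere (Gluck 1962,
§17; tree theorem `nonempty_homotopyEquiv_sphere_of_isGluckTwist_holds`) and dissolves
(`dissolvesInCP2_of_isGluckTwist'`). [cite: ManolescuMarengonSarkarWillis2023, Cor. 1.13 and §9.3]
[cite: GluckTAMS1962, §17] -/
theorem mmsw2023_sZero_of_dissolvesInCP2.rasmussen_eq_zero_of_isSliceDiscIn_gluckTwist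
    (h : mmsw2023_sZero_of_dissolvesInCP2) : rasmussen_eq_zero_of_isSliceDiscIn_gluckTwist := by
  intro K₂ X _ _ _ _ _ hX K e f hK s hs
  haveI : CompactSpace X := IsGluckTwist.compactSpace_holds hX
  exact h X (nonempty_homotopyEquiv_sphere_of_isGluckTwist_holds hX)
    (dissolvesInCP2_of_isGluckTwist' K₂ X hX) K e f hK s hs

/-! ### "Conclude as in Theorem 6.14": the fact from the one-sided bound -/

/-- **MMSW 2023, §9.3 with the last step of the proof of Cor. 6.15 made explicit.** The named fact
`mmsw2023_sZero_of_dissolvesInCP2` follows from the ONE-SIDED bound (hypothesis `hle`): every knot `K`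
slice, in the tree's orientation-free sense `Knot.IsSliceDiscIn`, in a closed smooth homotopy 4-sphere `X`
that `DissolvesInCP2` has `s(K) ≤ 0` — Equation (6.1) of the source for such `X` (`X # ℂℙ²bar ≅ ℂℙ²bar`,
so `K` is H-slice in `ℂℙ²bar`, and Cor. 6.13). Proof as printed ("conclude as in Theorem 6.14"): `hle`
gives `s(K) ≤ 0`; the same disc is a slice disc for `K.mirror` with respect to the reflected ball
(`Knot.IsSliceDiscIn.mirror`) in the same (unoriented) `X`, and `s(K.mirror) = -s(K)` (tree theorem
`HasRasmussenInvariant.mirror_holds`), so `hle` also gives `-s(K) ≤ 0`.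
[cite: ManolescuMarengonSarkarWillis2023, proof of Cor. 6.15 and Thm. 6.14] [cite: Rasmussen2010, §3.5] -/
theorem mmsw2023_sZero_of_dissolvesInCP2_of_nonpos
    (hle : ∀ (X : Type) [TopologicalSpace X] [T2Space X] [SecondCountableTopology X]
      [ChartedSpace (EuclideanSpace ℝ (Fin 4)) X] [IsManifold (𝓡 4) ∞ X] [CompactSpace X]
      (_hX : Nonempty (X ≃ₕ 𝕊⁴)) (_hd : DissolvesInCP2 X) (K : Knot)
      (e : EuclideanSpace ℝ (Fin 4) → X) (f : EuclideanSpace ℝ (Fin 2) → X)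
      (_hK : K.IsSliceDiscIn X e f) (s : ℤ) (_hs : K.HasRasmussenInvariant s), s ≤ 0) :
    mmsw2023_sZero_of_dissolvesInCP2 := by
  intro X _ _ _ _ _ _ hX hd K e f hK s hs
  have h₁ : s ≤ 0 := hle X hX hd K e f hK s hs
  have h₂ : -s ≤ 0 := hle X hX hd K.mirror _ f hK.mirror (-s) (HasRasmussenInvariant.mirror_holds hs)
  omega

/-- **What is left of MMSW 2023, §9.3 (`r = 1`, knots), exactly.** With no hypothesis, the named fact
`mmsw2023_sZero_of_dissolvesInCP2` is EQUIVALENT to the one-sided bound "`s ≤ 0` for every knot slice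
(tree sense) in a closed smooth homotopy 4-sphere that `DissolvesInCP2`": its content beyond the tree is
Equation (6.1) for dissolving spheres — the dissolution rewritten as H-sliceness in `ℂℙ²bar ∖ B̊⁴`, plus
Cor. 6.13 (`s(L) ≤ 1 - |L|` for links strongly H-slice in `#ᵗ ℂℙ²bar`, from the adjunction inequality).
[cite: ManolescuMarengonSarkarWillis2023, proof of Cor. 6.15 and Cor. 6.13] -/
theorem mmsw2023_sZero_of_dissolvesInCP2_iff_nonpos :
    mmsw2023_sZero_of_dissolvesInCP2 ↔
      ∀ (X : Type) [TopologicalSpace X] [T2Space X] [SecondCountableTopology X]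
        [ChartedSpace (EuclideanSpace ℝ (Fin 4)) X] [IsManifold (𝓡 4) ∞ X] [CompactSpace X]
        (_hX : Nonempty (X ≃ₕ 𝕊⁴)) (_hd : DissolvesInCP2 X) (K : Knot)
        (e : EuclideanSpace ℝ (Fin 4) → X) (f : EuclideanSpace ℝ (Fin 2) → X)
        (_hK : K.IsSliceDiscIn X e f) (s : ℤ) (_hs : K.HasRasmussenInvariant s), s ≤ 0 :=
  ⟨fun h X _ _ _ _ _ _ hX hd K e f hK s hs ↦ (h X hX hd K e f hK s hs).le,
    mmsw2023_sZero_of_dissolvesInCP2_of_nonpos⟩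

end Literature.Barriers.SmoothPoincare4

end
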